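import Mathlib
import HarnessLib
import Summits.NavierStokesRegularity.NavierStokesRegularity.Theorems.HalfSpaceWindowDoorCirculationCarryingRigidityAngularFluxHourglass

/-!
# Route `HalfSpaceWindowDoor`, crux `CirculationCarryingRigidity` (stmt-NavierStokesRegularity-25311) —
# line `angular_flux` (LEAD ns-hsw-p1 g13): the hourglass model of `…AngularFluxTightness` is EXACTLY SELF-SIMILAR

The circle data `(Γ, S)` of `…AngularFluxTightness.angularFlux_hourglass_model` — `Γ(r,z,t) = Φ(1 − e^{−r²/4τ})`, `τ = −t + θ²z²`,
`S(r,z,t) = −r⁻¹∫₀ʳ ρQ(ρ,z,t) dρ` — are invariant under the Navier–Stokes zoom in the way the circulation and the angular-momentum flux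
of a backward SELF-SIMILAR profile `v(x,t) = (−t)^{−1/2}U(x/√(−t))` are: for every `λ > 0`, `t < 0`,
`Γ(λr, λz, λ²t) = Γ(r,z,t)` and `S(λr, λz, λ²t) = λ⁻¹ S(r,z,t)` (`model_selfSimilar`; `Γ` is dimensionless, `S ~ velocity² × length`).
So even «self-similar + every one-axis budget + sign + finite flux + ledger rows» does not force `Γ ≡ 0` at the level of the circle
calculus — whereas genuine self-similar PROFILES of the door class are killed by Tsai's POINTWISE head-pressure maximum principle
(tree `eq_zero_of_selfSimilar`, line rot_bernoulli): pointwise structure succeeds exactly where circle budgets provably cannot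
(card `Lines/angular_flux.md` §2).  Pure real analysis; no new definitions.

Seat ns-hsw-p1 g13, `--supports stmt-NavierStokesRegularity-25311 --as helper`.  WHAT THIS IS NOT: not about NS regularity; a scaling
property of an explicit model; nothing is closed by this file.
-/

noncomputable section

-- the summit and its single sub-problem share the name (CONVENTIONS §1), as in every Theorems file
set_option linter.dupNamespace false

namespace Summit.NavierStokesRegularity.NavierStokesRegularity.Theorems.HalfSpaceWindowDoorCirculationCarryingRigidityAngularFluxSelfSimilar

open Set intervalIntegral MeasureTheory
open Summit.NavierStokesRegularity.NavierStokesRegularity.Theorems.HalfSpaceWindowDoorCirculationCarryingRigidityAngularFluxHourglass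

/-- The zoom leaves the Gaussian exponent invariant: `(λρ)²/(4(−λ²t + θ²(λz)²)) = ρ²/(4(−t + θ²z²))` (`λ ≠ 0`, `t < 0`). -/
theorem exponent_zoom (θ z ρ : ℝ) {t lam : ℝ} (ht : t < 0) (hlam : lam ≠ 0) :
    -((lam * ρ) ^ 2) / (4 * (-(lam ^ 2 * t) + θ ^ 2 * (lam * z) ^ 2)) = -(ρ ^ 2) / (4 * (-t + θ ^ 2 * z ^ 2)) := by
  have hτ := (tau_pos θ z ht).ne'
  have : -(lam ^ 2 * t) + θ ^ 2 * (lam * z) ^ 2 = lam ^ 2 * (-t + θ ^ 2 * z ^ 2) := by ring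
  rw [this]
  field_simp

/-- The source scales like `λ⁻²`: `Q(λρ, λz, λ²t) = λ⁻² Q(ρ, z, t)`. -/
theorem source_zoom (Φ θ z ρ : ℝ) {t lam : ℝ} (ht : t < 0) (hlam : lam ≠ 0) :
    Φ * (lam * ρ) ^ 2 * Real.exp (-((lam * ρ) ^ 2) / (4 * (-(lam ^ 2 * t) + θ ^ 2 * (lam * z) ^ 2)))
        / (2 * (-(lam ^ 2 * t) + θ ^ 2 * (lam * z) ^ 2) ^ 2)
        * (1 + θ ^ 2 + θ ^ 4 * (lam * z) ^ 2 * (lam * ρ) ^ 2 / (2 * (-(lam ^ 2 * t) + θ ^ 2 * (lam * z) ^ 2) ^ 2)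
          - 4 * θ ^ 4 * (lam * z) ^ 2 / (-(lam ^ 2 * t) + θ ^ 2 * (lam * z) ^ 2))
      = (lam ^ 2)⁻¹ * (Φ * ρ ^ 2 * Real.exp (-(ρ ^ 2) / (4 * (-t + θ ^ 2 * z ^ 2))) / (2 * (-t + θ ^ 2 * z ^ 2) ^ 2)
        * (1 + θ ^ 2 + θ ^ 4 * z ^ 2 * ρ ^ 2 / (2 * (-t + θ ^ 2 * z ^ 2) ^ 2) - 4 * θ ^ 4 * z ^ 2 / (-t + θ ^ 2 * z ^ 2))) := by
  rw [exponent_zoom θ z ρ ht hlam]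
  have hτ := (tau_pos θ z ht).ne'
  have : -(lam ^ 2 * t) + θ ^ 2 * (lam * z) ^ 2 = lam ^ 2 * (-t + θ ^ 2 * z ^ 2) := by ring
  rw [this]
  field_simp

/-- **The hourglass model is exactly self-similar**: for every `λ > 0`, `t < 0` and all `r, z`,
`Γ(λr, λz, λ²t) = Γ(r,z,t)` and `S(λr, λz, λ²t) = λ⁻¹ S(r,z,t)` for the data of `…AngularFluxTightness.angularFlux_hourglass_model`. -/
theorem model_selfSimilar (Φ θ r z : ℝ) {t lam : ℝ} (ht : t < 0) (hlam : 0 < lam) :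
    Φ * (1 - Real.exp (-((lam * r) ^ 2) / (4 * (-(lam ^ 2 * t) + θ ^ 2 * (lam * z) ^ 2))))
        = Φ * (1 - Real.exp (-(r ^ 2) / (4 * (-t + θ ^ 2 * z ^ 2)))) ∧
      -(∫ ρ in (0 : ℝ)..(lam * r), ρ * (Φ * ρ ^ 2 * Real.exp (-(ρ ^ 2) / (4 * (-(lam ^ 2 * t) + θ ^ 2 * (lam * z) ^ 2)))
          / (2 * (-(lam ^ 2 * t) + θ ^ 2 * (lam * z) ^ 2) ^ 2)
          * (1 + θ ^ 2 + θ ^ 4 * (lam * z) ^ 2 * ρ ^ 2 / (2 * (-(lam ^ 2 * t) + θ ^ 2 * (lam * z) ^ 2) ^ 2)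
            - 4 * θ ^ 4 * (lam * z) ^ 2 / (-(lam ^ 2 * t) + θ ^ 2 * (lam * z) ^ 2)))) / (lam * r)
        = lam⁻¹ * (-(∫ ρ in (0 : ℝ)..r, ρ * (Φ * ρ ^ 2 * Real.exp (-(ρ ^ 2) / (4 * (-t + θ ^ 2 * z ^ 2)))
          / (2 * (-t + θ ^ 2 * z ^ 2) ^ 2)
          * (1 + θ ^ 2 + θ ^ 4 * z ^ 2 * ρ ^ 2 / (2 * (-t + θ ^ 2 * z ^ 2) ^ 2) - 4 * θ ^ 4 * z ^ 2 / (-t + θ ^ 2 * z ^ 2)))) / r) := by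
  have hl0 : lam ≠ 0 := hlam.ne'
  refine ⟨by rw [exponent_zoom θ z r ht hl0], ?_⟩
  -- change of variables `ρ = λρ'` in the flux integral
  set g : ℝ → ℝ := fun ρ => ρ * (Φ * ρ ^ 2 * Real.exp (-(ρ ^ 2) / (4 * (-(lam ^ 2 * t) + θ ^ 2 * (lam * z) ^ 2)))
      / (2 * (-(lam ^ 2 * t) + θ ^ 2 * (lam * z) ^ 2) ^ 2)
      * (1 + θ ^ 2 + θ ^ 4 * (lam * z) ^ 2 * ρ ^ 2 / (2 * (-(lam ^ 2 * t) + θ ^ 2 * (lam * z) ^ 2) ^ 2)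
        - 4 * θ ^ 4 * (lam * z) ^ 2 / (-(lam ^ 2 * t) + θ ^ 2 * (lam * z) ^ 2))) with hg
  have hsub : ∫ ρ in (0 : ℝ)..(lam * r), g ρ = lam * ∫ ρ in (0 : ℝ)..r, g (lam * ρ) := by
    have h := intervalIntegral.smul_integral_comp_mul_left g lam (a := 0) (b := r)
    rw [mul_zero] at h
    rw [← h, smul_eq_mul]
  have hpt : ∀ ρ : ℝ, g (lam * ρ) = lam⁻¹ * (ρ * (Φ * ρ ^ 2 * Real.exp (-(ρ ^ 2) / (4 * (-t + θ ^ 2 * z ^ 2)))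
      / (2 * (-t + θ ^ 2 * z ^ 2) ^ 2)
      * (1 + θ ^ 2 + θ ^ 4 * z ^ 2 * ρ ^ 2 / (2 * (-t + θ ^ 2 * z ^ 2) ^ 2) - 4 * θ ^ 4 * z ^ 2 / (-t + θ ^ 2 * z ^ 2)))) :=
    fun ρ => by
    simp only [hg]
    rw [source_zoom Φ θ z ρ ht hl0]
    field_simp
  rw [hsub, intervalIntegral.integral_congr (fun ρ _ => hpt ρ), intervalIntegral.integral_const_mul]
  set I := ∫ ρ in (0 : ℝ)..r, ρ * (Φ * ρ ^ 2 * Real.exp (-(ρ ^ 2) / (4 * (-t + θ ^ 2 * z ^ 2)))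
      / (2 * (-t + θ ^ 2 * z ^ 2) ^ 2)
      * (1 + θ ^ 2 + θ ^ 4 * z ^ 2 * ρ ^ 2 / (2 * (-t + θ ^ 2 * z ^ 2) ^ 2) - 4 * θ ^ 4 * z ^ 2 / (-t + θ ^ 2 * z ^ 2))) with hI
  rcases eq_or_ne r 0 with hr | hr
  · subst hr; simp
  · field_simp

end Summit.NavierStokesRegularity.NavierStokesRegularity.Theorems.HalfSpaceWindowDoorCirculationCarryingRigidityAngularFluxSelfSimilar

end
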